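import Mathlib.LinearAlgebra.Matrix.PosDef
import Mathlib.LinearAlgebra.Matrix.NonsingularInverse
import Mathlib.Analysis.Complex.Basic
import Literature.Analysis.TotalPositivity.MultiplyPositiveProofs
import Literature.AlgebraicGeometry.Tropical.TorusCycles
import HarnessLib

/-!
# Crux `TropicalHodgeBound` (route `TropicalWeilObstruction`), line `birth`: the `dz ⊗ dz` pairing —
# all-maps Cauchy–Binet and the frame matrix `[1 | i·1]`

Helper file for the stubs `stub_weilFunctional_eq_pairing`, `stub_weilPairing_thetaClass`,
`stub_weilPairing_weilClasses` of the registered skeleton `Cruxes/TropicalHodgeBound/Lines/birth.lean`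
(crux item stmt-HodgeConjecture-18480); linear algebra over a commutative ring / over `ℂ`, general `n`:
* `sum_det_submatrix_mul_det_submatrix` — the **all-maps Cauchy–Binet formula**
  `Σ_{f : Fin k → ι} det A[·, f] · det B[f, ·] = k! · det (A B)`, with its "theta" form
  `Σ_{S,S'} det M[·,S] · det M'[·,S'] · det Q[S,S'] = (k!)² det (M Q M'ᵀ)` and its product form;
* the `n × 2n` complex matrix `P = [1 | i·1]` of `dz = dz₁ ∧ … ∧ dz_n`, `z_k = x_k + i x_{k+n}` (written
  out entrywise; the skeleton's `dzCoord n S` is `det P[·, S]`): `P Q Pᵀ = 0` for a real `Q` commuting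
  with `J = weilJ n`, `P Pᵀ = 0`, `P Pᴴ = 2`, `Pᴴ` = the skeleton's `omegaFrame n`, and `det (P Q Pᴴ) ≠ 0`
  for `Q` positive definite.

HONEST STATUS. Matrix identities only; nothing here is a statement about tropical cycles or Hodge
classes. No definition, no named fact, no sorry. References: [cite: Zharkov2020TropicalWeil, §2]
[cite: MikhalkinZharkov2014Eigenwave, Prop. 4.3]; Cauchy–Binet [folklore].
-/

set_option linter.dupNamespace false

noncomputable section

open scoped BigOperators
open Matrix

namespace Summit.HodgeConjecture.HodgeConjecture.Theorems.TropicalHodgeBound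

/-! ## §1 All-maps Cauchy–Binet -/

section CauchyBinet

variable {R : Type*} [CommRing R] {k : ℕ} {ι : Type*} [Fintype ι] [DecidableEq ι]

/-- **All-maps Cauchy–Binet.** `Σ_{f : Fin k → ι} det A[·, f] · det B[f, ·] = k! · det (A B)`: expand
`det B[f, ·]` over permutations `τ`, substitute `f ↦ f ∘ τ`, and use the one-sided expansion
`det (A B) = Σ_f (Π_i B (f i) i) · det A[·, f]` (`det_mul_eq_sum_pi`). [folklore] -/
theorem sum_det_submatrix_mul_det_submatrix (A : Matrix (Fin k) ι R) (B : Matrix ι (Fin k) R) :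
    ∑ f : Fin k → ι, (A.submatrix id f).det * (B.submatrix f id).det =
      (k.factorial : R) * (A * B).det := by
  calc ∑ f : Fin k → ι, (A.submatrix id f).det * (B.submatrix f id).det
      = ∑ f : Fin k → ι, ∑ τ : Equiv.Perm (Fin k), (A.submatrix id f).det *
          (((Equiv.Perm.sign τ : ℤ) : R) * ∏ i, B (f (τ i)) i) := by
        refine Finset.sum_congr rfl fun f _ => ?_
        rw [Matrix.det_apply' (B.submatrix f id), Finset.mul_sum]
        rfl
    _ = ∑ τ : Equiv.Perm (Fin k), ∑ f : Fin k → ι, (A.submatrix id f).det *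
          (((Equiv.Perm.sign τ : ℤ) : R) * ∏ i, B (f (τ i)) i) := Finset.sum_comm
    _ = ∑ _τ : Equiv.Perm (Fin k), (A * B).det := by
        refine Finset.sum_congr rfl fun τ _ => ?_
        rw [Literature.Analysis.TotalPositivity.det_mul_eq_sum_pi A B]
        refine Fintype.sum_equiv (Equiv.arrowCongr τ.symm (Equiv.refl ι)) _ _ fun f => ?_
        have hf : (Equiv.arrowCongr τ.symm (Equiv.refl ι)) f = f ∘ ⇑τ := by
          ext i; simp [Equiv.arrowCongr_apply]
        have hsub : A.submatrix id (f ∘ ⇑τ) = (A.submatrix id f).submatrix id ⇑τ := by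
          simp [Matrix.submatrix_submatrix]
        rw [hf, hsub, Matrix.det_permute']
        simp only [Function.comp_apply]
        ring
    _ = (k.factorial : R) * (A * B).det := by
        rw [Finset.sum_const, Finset.card_univ, Fintype.card_perm, Fintype.card_fin, nsmul_eq_mul]

/-- **Cauchy–Binet, theta form.** `Σ_{S,S'} det M[·,S] · det M'[·,S'] · det Q[S,S'] = (k!)² · det (M Q M'ᵀ)`
(Cauchy–Binet in `S` for fixed `S'`, then in `S'`). [folklore] -/
theorem sum_sum_det_mul_det_mul_det_submatrix (M M' : Matrix (Fin k) ι R) (Q : Matrix ι ι R) :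
    ∑ S : Fin k → ι, ∑ S' : Fin k → ι,
      (M.submatrix id S).det * (M'.submatrix id S').det * (Q.submatrix S S').det =
      (k.factorial : R) ^ 2 * (M * Q * M'ᵀ).det := by
  have inner : ∀ S' : Fin k → ι,
      ∑ S : Fin k → ι, (M.submatrix id S).det * (Q.submatrix S S').det =
        (k.factorial : R) * ((M * Q).submatrix id S').det := by
    intro S'
    have h := sum_det_submatrix_mul_det_submatrix M (Q.submatrix id S')
    have hMQ : M * Q.submatrix id S' = (M * Q).submatrix id S' := by
      rw [Matrix.submatrix_mul M Q id id S' Function.bijective_id, Matrix.submatrix_id_id]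
    rw [hMQ] at h
    simpa only [Matrix.submatrix_submatrix, Function.comp_id, Function.id_comp] using h
  calc ∑ S : Fin k → ι, ∑ S' : Fin k → ι,
        (M.submatrix id S).det * (M'.submatrix id S').det * (Q.submatrix S S').det
      = ∑ S' : Fin k → ι, (M'.submatrix id S').det *
          ∑ S : Fin k → ι, (M.submatrix id S).det * (Q.submatrix S S').det := by
        rw [Finset.sum_comm]
        refine Finset.sum_congr rfl fun S' _ => ?_
        rw [Finset.mul_sum]
        refine Finset.sum_congr rfl fun S _ => ?_
        ring
    _ = (k.factorial : R) * ∑ S' : Fin k → ι,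
          ((M * Q).submatrix id S').det * ((M'ᵀ).submatrix S' id).det := by
        rw [Finset.mul_sum]
        refine Finset.sum_congr rfl fun S' _ => ?_
        rw [inner, ← Matrix.transpose_submatrix, Matrix.det_transpose]
        ring
    _ = (k.factorial : R) ^ 2 * (M * Q * M'ᵀ).det := by
        rw [sum_det_submatrix_mul_det_submatrix]
        ring

/-- **Cauchy–Binet, product form.** For a decomposable class `(S, S') ↦ det X[S,·] · det Y[S',·]`:
`Σ_{S,S'} det M[·,S] · det M'[·,S'] · (det X[S,·] · det Y[S',·]) = (k! det (M X)) · (k! det (M' Y))`.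
[folklore] -/
theorem sum_sum_det_mul_det_mul_det_mul_det (M M' : Matrix (Fin k) ι R) (X Y : Matrix ι (Fin k) R) :
    ∑ S : Fin k → ι, ∑ S' : Fin k → ι, (M.submatrix id S).det * (M'.submatrix id S').det *
        ((X.submatrix S id).det * (Y.submatrix S' id).det) =
      ((k.factorial : R) * (M * X).det) * ((k.factorial : R) * (M' * Y).det) := by
  rw [← sum_det_submatrix_mul_det_submatrix M X, ← sum_det_submatrix_mul_det_submatrix M' Y,
    Finset.sum_mul_sum]
  refine Finset.sum_congr rfl fun S _ => Finset.sum_congr rfl fun S' _ => ?_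
  ring

end CauchyBinet

/-! ## §2 The frame matrix `P = [1 | i·1]` of `dz₁ ∧ … ∧ dz_n` -/

/-- `𝐏⟦n⟧` — the `n × 2n` complex matrix `[1 | i·1]`, `P k a = [a = k] + i·[a = k + n]` (display-only
local notation; nothing is defined). -/
local notation3 (prettyPrint := false) "𝐏⟦" n "⟧" =>
  (Matrix.of fun (k : Fin n) (a : Fin (2 * n)) =>
    (if (a : ℕ) = (k : ℕ) then (1 : ℂ) else 0) + (if (a : ℕ) = (k : ℕ) + n then Complex.I else 0))

section Frame

variable {n : ℕ} {ι : Type*}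

/-- Row action of `P = [1 | i·1]`: `(P X) k b = X k b + i · X (k+n) b`. [folklore] -/
theorem frame_mul_apply (X : Matrix (Fin (2 * n)) ι ℂ) (k : Fin n) (b : ι) :
    (𝐏⟦n⟧ * X) k b = X ⟨(k : ℕ), by omega⟩ b + Complex.I * X ⟨(k : ℕ) + n, by omega⟩ b := by
  rw [Matrix.mul_apply]
  simp only [Matrix.of_apply, add_mul, Finset.sum_add_distrib, ite_mul, one_mul, zero_mul]
  congr 1
  · rw [Finset.sum_eq_single ⟨(k : ℕ), by omega⟩]
    · simp
    · intro a _ ha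
      rw [if_neg]
      exact fun h => ha (Fin.ext h)
    · intro h; exact absurd (Finset.mem_univ _) h
  · rw [Finset.sum_eq_single ⟨(k : ℕ) + n, by omega⟩]
    · simp
    · intro a _ ha
      rw [if_neg]
      exact fun h => ha (Fin.ext h)
    · intro h; exact absurd (Finset.mem_univ _) h

/-- Column action of `Pᵀ`: `(X Pᵀ) a l = X a l + i · X a (l+n)`. [folklore] -/
theorem mul_frame_transpose_apply (X : Matrix ι (Fin (2 * n)) ℂ) (a : ι) (l : Fin n) :
    (X * (𝐏⟦n⟧)ᵀ) a l = X a ⟨(l : ℕ), by omega⟩ + Complex.I * X a ⟨(l : ℕ) + n, by omega⟩ := by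
  rw [Matrix.mul_apply]
  simp only [Matrix.transpose_apply, Matrix.of_apply, mul_add, Finset.sum_add_distrib, mul_ite,
    mul_one, mul_zero]
  congr 1
  · rw [Finset.sum_eq_single ⟨(l : ℕ), by omega⟩]
    · simp
    · intro b _ hb
      rw [if_neg]
      exact fun h => hb (Fin.ext h)
    · intro h; exact absurd (Finset.mem_univ _) h
  · rw [Finset.sum_eq_single ⟨(l : ℕ) + n, by omega⟩]
    · simp [mul_comm]
    · intro b _ hb
      rw [if_neg]
      exact fun h => hb (Fin.ext h)
    · intro h; exact absurd (Finset.mem_univ _) h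

/-- Column action of `Pᴴ`: `(X Pᴴ) a l = X a l - i · X a (l+n)`. [folklore] -/
theorem mul_frame_conjTranspose_apply (X : Matrix ι (Fin (2 * n)) ℂ) (a : ι) (l : Fin n) :
    (X * (𝐏⟦n⟧)ᴴ) a l = X a ⟨(l : ℕ), by omega⟩ - Complex.I * X a ⟨(l : ℕ) + n, by omega⟩ := by
  rw [Matrix.mul_apply]
  simp only [Matrix.conjTranspose_apply, Matrix.of_apply, star_add, mul_add,
    Finset.sum_add_distrib, apply_ite (star : ℂ → ℂ), star_one, star_zero, Complex.star_def,
    Complex.conj_I, mul_ite, mul_one, mul_zero, mul_neg]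
  rw [sub_eq_add_neg]
  congr 1
  · rw [Finset.sum_eq_single ⟨(l : ℕ), by omega⟩]
    · simp
    · intro b _ hb
      rw [if_neg]
      exact fun h => hb (Fin.ext h)
    · intro h; exact absurd (Finset.mem_univ _) h
  · rw [Finset.sum_eq_single ⟨(l : ℕ) + n, by omega⟩]
    · simp [mul_comm]
    · intro b _ hb
      rw [if_neg]
      exact fun h => hb (Fin.ext h)
    · intro h; exact absurd (Finset.mem_univ _) h

/-- `(Pᴴ v)` recovers `v` on the first `n` coordinates: `(Pᴴ v) k = v k` for `k < n`. [folklore] -/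
theorem frame_conjTranspose_mulVec_apply_lo (v : Fin n → ℂ) (k : Fin n) :
    ((𝐏⟦n⟧)ᴴ *ᵥ v) ⟨(k : ℕ), by omega⟩ = v k := by
  simp only [Matrix.mulVec, dotProduct, Matrix.conjTranspose_apply, Matrix.of_apply]
  rw [Finset.sum_eq_single k]
  · have h : ¬ ((k : ℕ) = (k : ℕ) + n) := by omega
    rw [if_neg h]
    simp
  · intro j _ hj
    have h1 : ¬ ((k : ℕ) = (j : ℕ)) := fun h => hj (Fin.ext h).symm
    have h2 : ¬ ((k : ℕ) = (j : ℕ) + n) := by omega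
    rw [if_neg h1, if_neg h2]
    simp
  · intro h; exact absurd (Finset.mem_univ _) h

/-- `P Pᵀ = 0` (`Σ_k dz_k ⊗ dz_k` is isotropic: `1 + i² = 0`). [folklore] -/
theorem frame_mul_frame_transpose : 𝐏⟦n⟧ * (𝐏⟦n⟧)ᵀ = 0 := by
  ext k l
  rw [mul_frame_transpose_apply, Matrix.zero_apply]
  simp only [Matrix.of_apply]
  have h1 : ¬ ((l : ℕ) = (k : ℕ) + n) := by omega
  have h2 : ¬ ((l : ℕ) + n = (k : ℕ)) := by omega
  rw [if_neg h1, if_neg h2]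
  by_cases h : (l : ℕ) = (k : ℕ)
  · rw [if_pos h, if_pos (by omega)]
    linear_combination Complex.I_mul_I
  · rw [if_neg h, if_neg (by omega)]
    simp

/-- `P Pᴴ = 2` (`|dz_k|² = 2`). [folklore] -/
theorem frame_mul_frame_conjTranspose : 𝐏⟦n⟧ * (𝐏⟦n⟧)ᴴ = (2 : ℂ) • (1 : Matrix (Fin n) (Fin n) ℂ) := by
  ext k l
  rw [mul_frame_conjTranspose_apply, Matrix.smul_apply, Matrix.one_apply]
  simp only [Matrix.of_apply, smul_eq_mul, mul_ite, mul_one, mul_zero]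
  have h1 : ¬ ((l : ℕ) = (k : ℕ) + n) := by omega
  have h2 : ¬ ((l : ℕ) + n = (k : ℕ)) := by omega
  rw [if_neg h1, if_neg h2]
  by_cases h : (l : ℕ) = (k : ℕ)
  · rw [if_pos h, if_pos (by omega), if_pos (Fin.ext h).symm]
    linear_combination (-1 : ℂ) * Complex.I_mul_I
  · rw [if_neg h, if_neg (by omega), if_neg (fun h' => h (congrArg Fin.val h').symm)]
    simp

/-- `det (P Pᴴ) = 2ⁿ ≠ 0`. [folklore] -/
theorem det_frame_mul_frame_conjTranspose : (𝐏⟦n⟧ * (𝐏⟦n⟧)ᴴ).det = 2 ^ n := by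
  rw [frame_mul_frame_conjTranspose, Matrix.det_smul, Matrix.det_one, Fintype.card_fin, mul_one]

/-- `Pᴴ` written out: `Pᴴ a b = [a = b] - i·[a = b + n]` (the skeleton's `omegaFrame n`, the frame
`ω_b = e_b - i e_{b+n}` of Zharkov's `Ω`). [cite: Zharkov2020TropicalWeil, §2] -/
theorem frame_conjTranspose_eq :
    (𝐏⟦n⟧)ᴴ = Matrix.of fun (a : Fin (2 * n)) (b : Fin n) =>
      (if (a : ℕ) = (b : ℕ) then (1 : ℂ) else 0) - (if (a : ℕ) = (b : ℕ) + n then Complex.I else 0) := by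
  ext a b
  simp only [Matrix.conjTranspose_apply, Matrix.of_apply, star_add, apply_ite (star : ℂ → ℂ),
    star_one, star_zero, Complex.star_def, Complex.conj_I]
  split_ifs <;> ring

/-- Complex conjugate of `Pᴴ` is `Pᵀ`. [folklore] -/
theorem frame_conjTranspose_map_conj : ((𝐏⟦n⟧)ᴴ).map (starRingEnd ℂ) = (𝐏⟦n⟧)ᵀ := by
  ext a b
  simp only [Matrix.map_apply, Matrix.conjTranspose_apply, Matrix.transpose_apply,
    Complex.star_def, starRingEnd_self_apply]

/-! ### `P Q Pᵀ = 0` for `Q` commuting with `J` -/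

/-- `(X J) a l = X a (l+n)` for `l < n`. [cite: Zharkov2020TropicalWeil, §2] -/
theorem mul_weilJ_apply_lo (X : Matrix ι (Fin (2 * n)) ℝ) (a : ι) (l : Fin n) :
    (X * Literature.AlgebraicGeometry.Tropical.weilJ n) a ⟨(l : ℕ), by omega⟩ =
      X a ⟨(l : ℕ) + n, by omega⟩ := by
  rw [Matrix.mul_apply, Finset.sum_eq_single ⟨(l : ℕ) + n, by omega⟩]
  · simp [Literature.AlgebraicGeometry.Tropical.weilJ]
  · intro b _ hb
    have hb' : ¬ ((b : ℕ) = (l : ℕ) + n) := fun h => hb (Fin.ext h)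
    simp only [Literature.AlgebraicGeometry.Tropical.weilJ]
    rw [if_neg hb', if_neg (by omega), mul_zero]
  · intro h; exact absurd (Finset.mem_univ _) h

/-- `(X J) a (l+n) = - X a l` for `l < n`. [cite: Zharkov2020TropicalWeil, §2] -/
theorem mul_weilJ_apply_hi (X : Matrix ι (Fin (2 * n)) ℝ) (a : ι) (l : Fin n) :
    (X * Literature.AlgebraicGeometry.Tropical.weilJ n) a ⟨(l : ℕ) + n, by omega⟩ =
      - X a ⟨(l : ℕ), by omega⟩ := by
  rw [Matrix.mul_apply, Finset.sum_eq_single ⟨(l : ℕ), by omega⟩]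
  · have h1 : ¬ ((l : ℕ) = (l : ℕ) + n + n) := by omega
    simp [Literature.AlgebraicGeometry.Tropical.weilJ, h1]
  · intro b _ hb
    have hb' : ¬ ((l : ℕ) + n = (b : ℕ) + n) := fun h => hb (Fin.ext (by simpa using h.symm))
    simp only [Literature.AlgebraicGeometry.Tropical.weilJ]
    rw [if_neg (by omega), if_neg hb', mul_zero]
  · intro h; exact absurd (Finset.mem_univ _) h

/-- `(J X) k c = - X (k+n) c` for `k < n`. [cite: Zharkov2020TropicalWeil, §2] -/
theorem weilJ_mul_apply_lo (X : Matrix (Fin (2 * n)) ι ℝ) (k : Fin n) (c : ι) :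
    (Literature.AlgebraicGeometry.Tropical.weilJ n * X) ⟨(k : ℕ), by omega⟩ c =
      - X ⟨(k : ℕ) + n, by omega⟩ c := by
  rw [Matrix.mul_apply, Finset.sum_eq_single ⟨(k : ℕ) + n, by omega⟩]
  · have h1 : ¬ ((k : ℕ) = (k : ℕ) + n + n) := by omega
    simp [Literature.AlgebraicGeometry.Tropical.weilJ, h1]
  · intro b _ hb
    have hb' : ¬ ((b : ℕ) = (k : ℕ) + n) := fun h => hb (Fin.ext h)
    simp only [Literature.AlgebraicGeometry.Tropical.weilJ]
    rw [if_neg (by omega), if_neg hb', zero_mul]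
  · intro h; exact absurd (Finset.mem_univ _) h

/-- `(J X) (k+n) c = X k c` for `k < n`. [cite: Zharkov2020TropicalWeil, §2] -/
theorem weilJ_mul_apply_hi (X : Matrix (Fin (2 * n)) ι ℝ) (k : Fin n) (c : ι) :
    (Literature.AlgebraicGeometry.Tropical.weilJ n * X) ⟨(k : ℕ) + n, by omega⟩ c =
      X ⟨(k : ℕ), by omega⟩ c := by
  rw [Matrix.mul_apply, Finset.sum_eq_single ⟨(k : ℕ), by omega⟩]
  · simp [Literature.AlgebraicGeometry.Tropical.weilJ]
  · intro b _ hb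
    have hb' : ¬ ((k : ℕ) + n = (b : ℕ) + n) := fun h => hb (Fin.ext (by simpa using h.symm))
    simp only [Literature.AlgebraicGeometry.Tropical.weilJ]
    rw [if_neg hb', if_neg (by omega), zero_mul]
  · intro h; exact absurd (Finset.mem_univ _) h

/-- **`P Q Pᵀ = 0` for `Q J = J Q`.** `J`-commutation pins `Q = [[A, B], [-B, A]]`, and
`P Q Pᵀ = (A - A) + i (B - B) = 0` — the identity behind `Ŵ(θ_n(Q)) = det (P Q Pᵀ) = 0`.
[cite: Zharkov2020TropicalWeil, §2] -/
theorem frame_mul_map_mul_frame_transpose_eq_zero (Q : Matrix (Fin (2 * n)) (Fin (2 * n)) ℝ)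
    (hJ : Q * Literature.AlgebraicGeometry.Tropical.weilJ n =
      Literature.AlgebraicGeometry.Tropical.weilJ n * Q) :
    𝐏⟦n⟧ * Q.map ((↑) : ℝ → ℂ) * (𝐏⟦n⟧)ᵀ = 0 := by
  ext k l
  have h1 := congrFun (congrFun hJ ⟨(k : ℕ), by omega⟩) ⟨(l : ℕ), by omega⟩
  have h2 := congrFun (congrFun hJ ⟨(k : ℕ), by omega⟩) ⟨(l : ℕ) + n, by omega⟩
  rw [mul_weilJ_apply_lo, weilJ_mul_apply_lo] at h1
  rw [mul_weilJ_apply_hi, weilJ_mul_apply_lo] at h2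
  rw [mul_frame_transpose_apply, frame_mul_apply, frame_mul_apply, Matrix.zero_apply]
  simp only [Matrix.map_apply]
  have h1' : ((Q ⟨(k : ℕ), by omega⟩ ⟨(l : ℕ) + n, by omega⟩ : ℝ) : ℂ) =
      -((Q ⟨(k : ℕ) + n, by omega⟩ ⟨(l : ℕ), by omega⟩ : ℝ) : ℂ) := by
    rw [h1, Complex.ofReal_neg]
  have h2' : ((Q ⟨(k : ℕ) + n, by omega⟩ ⟨(l : ℕ) + n, by omega⟩ : ℝ) : ℂ) =
      ((Q ⟨(k : ℕ), by omega⟩ ⟨(l : ℕ), by omega⟩ : ℝ) : ℂ) := by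
    rw [neg_inj.mp h2]
  linear_combination Complex.I * h1' - h2' +
    ((Q ⟨(k : ℕ) + n, by omega⟩ ⟨(l : ℕ) + n, by omega⟩ : ℝ) : ℂ) * Complex.I_mul_I

/-! ### `det (P Q Pᴴ) ≠ 0` for `Q` positive definite -/

/-- A real positive definite `Q` has no complex isotropic vectors: `w̄ᵀ Q w = 0 ⟹ w = 0`
(`Re (w̄ᵀ Q w) = xᵀ Q x + yᵀ Q y` for `w = x + i y`). [folklore] -/
theorem eq_zero_of_star_dotProduct_map_mulVec_eq_zero {m : Type*} [Fintype m]
    {Q : Matrix m m ℝ} (hQ : Q.PosDef) {w : m → ℂ}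
    (hw : star w ⬝ᵥ (Q.map ((↑) : ℝ → ℂ) *ᵥ w) = 0) : w = 0 := by
  set x : m → ℝ := fun a => (w a).re with hx
  set y : m → ℝ := fun a => (w a).im with hy
  have hre : (star w ⬝ᵥ (Q.map ((↑) : ℝ → ℂ) *ᵥ w)).re = x ⬝ᵥ (Q *ᵥ x) + y ⬝ᵥ (Q *ᵥ y) := by
    simp only [dotProduct, Matrix.mulVec, Complex.re_sum, Pi.star_apply, Complex.mul_re,
      Complex.star_def, Complex.conj_re, Complex.conj_im, Matrix.map_apply,
      Complex.im_sum, Complex.im_ofReal_mul, Complex.ofReal_re, Complex.ofReal_im, hx, hy,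
      ← Finset.sum_add_distrib]
    refine Finset.sum_congr rfl fun a _ => ?_
    rw [Finset.mul_sum, Finset.mul_sum, Finset.mul_sum, Finset.mul_sum, ← Finset.sum_sub_distrib,
      ← Finset.sum_add_distrib]
    refine Finset.sum_congr rfl fun b _ => ?_
    ring
  have h0 : x ⬝ᵥ (Q *ᵥ x) + y ⬝ᵥ (Q *ᵥ y) = 0 := by rw [← hre, hw, Complex.zero_re]
  have hx0 : 0 ≤ x ⬝ᵥ (Q *ᵥ x) := by
    simpa only [star_trivial] using hQ.posSemidef.dotProduct_mulVec_nonneg x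
  have hy0 : 0 ≤ y ⬝ᵥ (Q *ᵥ y) := by
    simpa only [star_trivial] using hQ.posSemidef.dotProduct_mulVec_nonneg y
  have hx1 : x = 0 := by
    by_contra h
    have := hQ.dotProduct_mulVec_pos h
    simp only [star_trivial] at this
    linarith
  have hy1 : y = 0 := by
    by_contra h
    have := hQ.dotProduct_mulVec_pos h
    simp only [star_trivial] at this
    linarith
  funext a
  apply Complex.ext
  · simpa [hx] using congrFun hx1 a
  · simpa [hy] using congrFun hy1 a

/-- **`det (P Q Pᴴ) ≠ 0` for `Q ≻ 0`** (`P Q Pᴴ = 2 (A - iB)` is the hermitian form of `Q` on `V^{1,0}`):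
a kernel vector `v` gives the isotropic vector `w = Pᴴ v` of `Q`, so `w = 0` and `v = w|_{<n} = 0`.
[cite: Zharkov2020TropicalWeil, §2] -/
theorem det_frame_mul_map_mul_conjTranspose_ne_zero (Q : Matrix (Fin (2 * n)) (Fin (2 * n)) ℝ)
    (hQ : Q.PosDef) : (𝐏⟦n⟧ * Q.map ((↑) : ℝ → ℂ) * (𝐏⟦n⟧)ᴴ).det ≠ 0 := by
  suffices h : Function.Injective (𝐏⟦n⟧ * Q.map ((↑) : ℝ → ℂ) * (𝐏⟦n⟧)ᴴ).mulVec by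
    have hU := Matrix.mulVec_injective_iff_isUnit.mp h
    rw [Matrix.isUnit_iff_isUnit_det] at hU
    exact hU.ne_zero
  rw [← Matrix.coe_mulVecLin]
  refine (injective_iff_map_eq_zero _).mpr fun v hv => ?_
  rw [Matrix.coe_mulVecLin] at hv
  set w : Fin (2 * n) → ℂ := (𝐏⟦n⟧)ᴴ *ᵥ v with hwdef
  have hw : star w ⬝ᵥ (Q.map ((↑) : ℝ → ℂ) *ᵥ w) = 0 := by
    have h0 : star v ⬝ᵥ ((𝐏⟦n⟧ * Q.map ((↑) : ℝ → ℂ) * (𝐏⟦n⟧)ᴴ) *ᵥ v) = 0 := by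
      rw [hv, dotProduct_zero]
    rw [← Matrix.mulVec_mulVec, ← Matrix.mulVec_mulVec, Matrix.dotProduct_mulVec] at h0
    rw [hwdef, Matrix.star_mulVec, Matrix.conjTranspose_conjTranspose]
    exact h0
  have hw0 : w = 0 := eq_zero_of_star_dotProduct_map_mulVec_eq_zero hQ hw
  funext k
  rw [Pi.zero_apply, ← frame_conjTranspose_mulVec_apply_lo v k, ← hwdef, hw0, Pi.zero_apply]

end Frame

end Summit.HodgeConjecture.HodgeConjecture.Theorems.TropicalHodgeBound

end
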